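/-
Copyright (c) 2026. Released under Apache 2.0 license.
-/
import Summits.RiemannHypothesis.RiemannHypothesis.Theorems.MotivicDoorSemilocalQuinticWitness
import Summits.RiemannHypothesis.RiemannHypothesis.Theorems.WeilGroundStateGroundStateSimpleEvenTrialUpperFRho
import Literature.NumberTheory.LFunctions.WeilWindowSuzukiProofs
import Literature.NumberTheory.LFunctions.WeilWindowSuzukiAsymptoticProofs
import HarnessLib

/-!
# Motivic door, semi-local ladder — the archimedean density along the quintic witness

Pub speedrun, cell `pub-rhdoor`, seat `lad-2`, generation 4 (file 4 of the rung R3⁻(0.59)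
chain).  Elementary closed form and majorants for the archimedean density
`w(t) = e^{t/2} / (2 sinh t) = e^{-t/2} / (1 - e^{-2t})` of the Markov form
(`Literature.NumberTheory.LFunctions.WeilMarkovQuadratic.weilArchDensity`):

* (reused from the tree, not restated: `GroundStateSimpleEven.tuf_weilArchDensity_eq_z` — the
  closed form `w = e^{-t/2}/(1 - e^{-2t})` —, `weilArchDensity_antitoneOn`, `measurable_weilArchDensity`),
* `weilArchDensity_le_inv : w(t) ≤ 1/(2t) + 1`,
* `weilArchDensity_le_tail : w(t) ≤ e^{-t/2} + e^{-5t/2} + e^{-9t/2}/(1 - e^{-2c})` for `t ≥ c`,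
* `integrableOn_w_mul_weilIncrement_GQ`: `w · D(G)` is integrable on `(0, ∞)` for the quintic
  witness `G` (the finiteness hypothesis of the negativity criterion).

PROVED: everything stated (sorry-free, standard axioms).
-/

set_option linter.dupNamespace false

noncomputable section

open MeasureTheory Set Filter Topology Real Finset
open Literature.NumberTheory.LFunctions

namespace Summit.RiemannHypothesis.RiemannHypothesis.Theorems.MotivicDoor.SemilocalQuintic

open SemilocalMarkov GroundStateSimpleEven

/-! ## The archimedean density -/

/-- `w(t) ≤ 1/(2t) + 1` for `t > 0`. -/
theorem weilArchDensity_le_inv {t : ℝ} (ht : 0 < t) :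
    weilArchDensity t ≤ 1 / (2 * t) + 1 := by
  rw [tuf_weilArchDensity_eq_z ht]
  have h4 : Real.exp (-(t / 2)) ^ 4 = Real.exp (-(2 * t)) := by
    rw [← Real.exp_nat_mul]; ring_nf
  rw [h4]
  have hq : Real.exp (-(2 * t)) ≤ 1 / (1 + 2 * t) := by
    rw [Real.exp_neg, one_div]
    exact inv_anti₀ (by linarith) (by linarith [Real.add_one_le_exp (2 * t)])
  have hq1 : Real.exp (-(2 * t)) < 1 := Real.exp_lt_one_iff.2 (by linarith)
  have hn : Real.exp (-(t / 2)) ≤ 1 := Real.exp_le_one_iff.2 (by linarith)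
  have hden : 2 * t / (1 + 2 * t) ≤ 1 - Real.exp (-(2 * t)) := by
    have : 2 * t / (1 + 2 * t) = 1 - 1 / (1 + 2 * t) := by field_simp; ring
    linarith
  calc Real.exp (-(t / 2)) / (1 - Real.exp (-(2 * t)))
      ≤ 1 / (2 * t / (1 + 2 * t)) :=
        div_le_div₀ zero_le_one hn (by positivity) hden
    _ = 1 / (2 * t) + 1 := by field_simp

/-- `t w(t) ≤ 1/2 + t` for `t > 0`. -/
theorem mul_weilArchDensity_le {t : ℝ} (ht : 0 < t) : t * weilArchDensity t ≤ 1 / 2 + t := by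
  have := mul_le_mul_of_nonneg_left (weilArchDensity_le_inv ht) ht.le
  calc t * weilArchDensity t ≤ t * (1 / (2 * t) + 1) := this
    _ = 1 / 2 + t := by field_simp

/-- Three-term tail majorant: for `0 < c ≤ t`,
`w(t) ≤ e^{-t/2} + e^{-5t/2} + e^{-9t/2} / (1 - e^{-2c})`. -/
theorem weilArchDensity_le_tail {c t : ℝ} (hc : 0 < c) (hct : c ≤ t) :
    weilArchDensity t ≤ Real.exp (-(t / 2)) + Real.exp (-(5 * t / 2))
      + Real.exp (-(9 * t / 2)) / (1 - Real.exp (-(2 * c))) := by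
  have ht : 0 < t := lt_of_lt_of_le hc hct
  rw [tuf_weilArchDensity_eq_z ht]
  set e := Real.exp (-(t / 2)) with he
  have he0 : 0 < e := Real.exp_pos _
  have hq : e ^ 4 = Real.exp (-(2 * t)) := by rw [he, ← Real.exp_nat_mul]; ring_nf
  have h5 : Real.exp (-(5 * t / 2)) = e * e ^ 4 := by
    rw [he, ← pow_succ', ← Real.exp_nat_mul]; ring_nf
  have h9 : Real.exp (-(9 * t / 2)) = e * (e ^ 4) ^ 2 := by
    rw [he, ← pow_mul, ← pow_succ', ← Real.exp_nat_mul]; ring_nf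
  rw [h5, h9]
  set q := e ^ 4 with hq'
  have hq0 : 0 < q := by positivity
  have hqc : q ≤ Real.exp (-(2 * c)) := by rw [hq]; exact Real.exp_le_exp.2 (by linarith)
  have hc1 : Real.exp (-(2 * c)) < 1 := Real.exp_lt_one_iff.2 (by linarith)
  have hq1 : q < 1 := lt_of_le_of_lt hqc hc1
  -- 1/(1-q) = 1 + q + q²/(1-q) ≤ 1 + q + q²/(1 - e^{-2c})
  have h1q : (1 : ℝ) - q ≠ 0 := (sub_pos.2 hq1).ne'
  have key : e / (1 - q) = e + e * q + e * q ^ 2 / (1 - q) := by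
    field_simp; ring
  rw [key]
  have : e * q ^ 2 / (1 - q) ≤ e * q ^ 2 / (1 - Real.exp (-(2 * c))) :=
    div_le_div_of_nonneg_left (by positivity) (by linarith) (by linarith)
  linarith

/-! ## Integrability of `w · D(G)` -/

/-- `w(t) D_t(G)` is integrable on `(0, ∞)`. -/
theorem integrableOn_w_mul_weilIncrement_GQ :
    IntegrableOn (fun t ↦ weilArchDensity t * weilIncrement GQ t) (Ioi 0) := by
  have hb := bQ_pos
  have hsplit : Ioi (0 : ℝ) = Ioc 0 (2 * bQ) ∪ Ioi (2 * bQ) :=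
    (Ioc_union_Ioi_eq_Ioi (by linarith)).symm
  rw [hsplit]
  refine IntegrableOn.union ?_ ?_
  · -- bounded on a bounded interval
    obtain ⟨Cq, hCq⟩ := isCompact_Icc.exists_bound_of_continuousOn
      (s := Icc (0 : ℝ) 2) (continuous_polyR qL).continuousOn
    have hm : Measurable fun t ↦ 2 * (t * weilArchDensity t) * polyR qL (t / bQ) :=
      (measurable_const.mul (measurable_id.mul measurable_weilArchDensity)).mul
        ((continuous_polyR qL).measurable.comp (measurable_id.div_const bQ))
    have hint : IntegrableOn (fun t ↦ 2 * (t * weilArchDensity t) * polyR qL (t / bQ))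
        (Ioc 0 (2 * bQ)) := by
      refine Measure.integrableOn_of_bounded (M := 2 * (1 / 2 + 2 * bQ) * Cq)
        measure_Ioc_lt_top.ne hm.aestronglyMeasurable ?_
      rw [ae_restrict_iff' measurableSet_Ioc]
      refine Eventually.of_forall fun t ht ↦ ?_
      have ht0 : 0 < t := ht.1
      have hτ : t / bQ ∈ Icc (0 : ℝ) 2 :=
        ⟨by positivity, by rw [div_le_iff₀ hb]; linarith [ht.2]⟩
      rw [norm_mul, norm_mul, Real.norm_eq_abs, Real.norm_eq_abs,
        abs_of_nonneg (by positivity : (0:ℝ) ≤ 2),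
        abs_of_nonneg (mul_nonneg ht0.le (weilArchDensity_pos ht0).le)]
      have h1 := mul_weilArchDensity_le ht0
      have h2 := hCq _ hτ
      have hC0 : 0 ≤ Cq := le_trans (norm_nonneg _) h2
      exact mul_le_mul (by nlinarith [ht.2]) h2 (norm_nonneg _) (by positivity)
    refine hint.congr_fun (fun t ht ↦ ?_) measurableSet_Ioc
    rw [weilIncrement_GQ_eq ht.1.le ht.2, polyR_dL]
    field_simp
  · -- exponentially small on the tail
    have hdom : IntegrableOn (fun t ↦ 2 * Real.exp (-(1 / 2) * t) * (2 * NQ)) (Ioi (2 * bQ)) :=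
      ((exp_neg_integrableOn_Ioi _ (by norm_num : (0:ℝ) < 1 / 2)).const_mul 2).mul_const _
    have hint : IntegrableOn (fun t ↦ weilArchDensity t * (2 * NQ)) (Ioi (2 * bQ)) := by
      refine hdom.mono' (measurable_weilArchDensity.mul_const _).aestronglyMeasurable ?_
      rw [ae_restrict_iff' measurableSet_Ioi]
      refine Eventually.of_forall fun t (ht : 2 * bQ < t) ↦ ?_
      have ht0 : 0 < t := by linarith
      rw [norm_mul, Real.norm_eq_abs, Real.norm_eq_abs, abs_of_pos (weilArchDensity_pos ht0)]
      have hN : 0 ≤ 2 * NQ := by unfold NQ n2Q bQ; norm_num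
      rw [abs_of_nonneg hN]
      refine mul_le_mul_of_nonneg_right ?_ hN
      rw [tuf_weilArchDensity_eq_z ht0]
      have h4 : Real.exp (-(t / 2)) ^ 4 ≤ 1 / 2 := by
        rw [← Real.exp_nat_mul]
        have h1 : Real.exp ((4:ℕ) * -(t / 2)) ≤ Real.exp (-1) :=
          Real.exp_le_exp.2 (by unfold bQ at ht; push_cast; linarith)
        refine h1.trans ?_
        have := Real.exp_one_gt_d9
        rw [Real.exp_neg, inv_le_comm₀ (Real.exp_pos _) (by norm_num)]
        linarith
      rw [show -(1 / 2) * t = -(t / 2) by ring, div_le_iff₀ (by linarith)]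
      nlinarith [Real.exp_pos (-(t / 2))]
    exact hint.congr_fun (fun t ht ↦ by rw [weilIncrement_GQ_eq_of_lt (mem_Ioi.1 ht)])
      measurableSet_Ioi

end Summit.RiemannHypothesis.RiemannHypothesis.Theorems.MotivicDoor.SemilocalQuintic

end
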